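import Literature.AlgebraicGeometry.AbelianSchemes.AbelianSchemeQuotientDualPairExistsLocal
import Literature.AlgebraicGeometry.AbelianSchemes.AbelianSchemeQuotientDualPairUniversal
import HarnessLib

/-!
# The universal property of the dual pair of `A/K` from the level data: `h4` modulo (K) and (u6b) (HECKE-LINK H2, D6 junction)

Layer `Literature/AlgebraicGeometry/AbelianSchemes`, namespace `Literature.AlgebraicGeometry.AbelianSchemes.AbelianSchemeOver`.
THEOREMS ONLY; no definition, no named fact, no instance, no notation, no `sorry`.

[MumfordAV1970] §15 Thm. 1 («the dual of `A/K` is `Â/K^⊥`»), [MilneAV2008] I §8–§9: the JUNCTION of the two D6 halves —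
★ `AbelianSchemeQuotientDualPairExistsLocal` (B-p08 (g10), (u1)+(u2): fpqc-local EXISTENCE of the classifying map from a
level-`n` structure `φ̂` on `Â`, the count `#K · #K′ = n^{2g}`, the unit hypothesis `hD` and the stabiliser hypothesis (K)) and ★
`AbelianSchemeQuotientDualPairUniversal` (B-p18 (g17), (α2): descent of the map and of the isomorphism, from (K) `hStab` and the
fpqc-descent hypothesis (u6b) `hdesc`) — as ONE name for the `h4` binder of ★ `dualPairOfQuotientRigidified`:

* **`universal_poincareQuotRigid_of_level (φ̂) (hn) (hcard) (hD) (hStab) (hdesc)`** — for `S` reduced and locally Noetherian, `Â`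
  commutative, `n` invertible in the residue fields of `S`: the field `universal` of the dual pair `(Â/K′, 𝒫_B^{rig})` of `A/K`
  TOKEN-FOR-TOKEN, modulo exactly `hStab` (★ `hStab_of_level_of_count`, B-p09) and `hdesc` ((u6b), B-p13);
* `exists_pullback_poincareQuotRigid_iso_of_level` — its `∃` half (the `hex` of ★ `existsUnique_poincareQuotRigid_of_exists`).

Cell `hodgecm-mathlib`, HECKE-LINK socket (B) file (ii), D6 (composer B-p04 (g18) feeds `hExt`'s `h4` conjunct with this name).
HC_CM is proved only modulo the 7 printed citations until rung 0 closes; nothing here is about HC.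

## References
* [MumfordAV1970] D. Mumford, *Abelian Varieties* (1970), §15 Thm. 1 (p. 143).
* [MilneAV2008] J. S. Milne, *Abelian Varieties* (2008), I §8 (pp. 36–37), I §9 Thm. 9.1 (p. 42).
-/

noncomputable section

-- `(A.baseChange f).X = (Over.pullback f).obj A.X` / `(A.X ⊗ B.X).left = A.prodLeft B` hold by `rfl` only.
set_option backward.isDefEq.respectTransparency false

universe u

open CategoryTheory CategoryTheory.Limits AlgebraicGeometry MonoidalCategory CartesianMonoidalCategory
open scoped MonObj

namespace Literature.AlgebraicGeometry.AbelianSchemes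

namespace AbelianSchemeOver

open Literature.AlgebraicGeometry.RelativeSpec Literature.AlgebraicGeometry.AbelianVarieties
  Literature.AlgebraicGeometry.Motives Literature.AlgebraicGeometry.Modules

variable {S : Scheme.{u}} (A : AbelianSchemeOver S)
  {Y : Scheme.{u}} (u : S ⟶ Y) (K : Subgroup A.Sections) [IsCommMonObj A.X] {n : ℕ}
  (hK : ∀ σ : K, (σ : A.Sections) ^ n = 1)
  [Finite K] [Y.IsSeparated] [IsSeparated (A.X.hom ≫ u)] [S.IsSeparated]
  (hcov : ∀ x : A.left, ∃ O : (A.translationActionOver u K).StableAffineOpens, x ∈ O.1)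
  [LocallyOfFiniteType (A.X.hom ≫ u)] [IsLocallyNoetherian Y]
  (hG : ∃ _ : GrpObj (A.quotientOver u K), IsMonHom (A.quotientMk u K hcov))
  (hsm : Smooth (A.quotientOver u K).hom) (hgc : GeometricallyConnected (A.quotientOver u K).hom)
  (D : A.DualPair) [IsAffine Y]
  (hfree : ∀ (Ω : Type u) [Field Ω] [IsAlgClosed Ω] (x : Spec (.of Ω) ⟶ A.left) (σ : K), σ ≠ 1 →
    x ≫ (A.translation (σ : A.Sections)).left ≠ x)

variable
  -- the dual side: a finite subgroup `K′ ≤ Â(S)` with the file-(i) hypotheses for `(Â, K′)`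
  (K' : Subgroup D.hat.Sections) [Finite K'] [IsSeparated (D.hat.X.hom ≫ u)]
  (hcov' : ∀ x : D.hat.left, ∃ O : (D.hat.translationActionOver u K').StableAffineOpens, x ∈ O.1)
  [LocallyOfFiniteType (D.hat.X.hom ≫ u)]
  (hG' : ∃ _ : GrpObj (D.hat.quotientOver u K'), IsMonHom (D.hat.quotientMk u K' hcov'))
  (hsm' : Smooth (D.hat.quotientOver u K').hom) (hgc' : GeometricallyConnected (D.hat.quotientOver u K').hom)
  (hfree' : ∀ (Ω : Type u) [Field Ω] [IsAlgClosed Ω] (x : Spec (.of Ω) ⟶ D.hat.left) (σ : K'), σ ≠ 1 →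
    x ≫ (D.hat.translation (σ : D.hat.Sections)).left ≠ x)
  -- D3b's output: a `K′`-equivariant structure on `𝒩₁` for the D3a action
  (Φ : (prodTranslationActionOver (A.quotientBy u K hcov hG hsm hgc) D.hat u K' hcov').EquivariantStructure
    (A.poincarePullback u K hK hcov hG hsm hgc D hfree))

include hfree' in
/-- **The `∃` half of the universal property of `(Â/K′, 𝒫_B^{rig})` from the level data** (= the `hex` of ★
`existsUnique_poincareQuotRigid_of_exists`): ★ `exists_pullback_poincareQuotRigid_iso_of_fpqcLocal` fed with ★
`exists_fpqcCover_pullback_poincareQuotRigid_iso_of_isLocallyNoetherian`. [cite: MumfordAV1970, §15 Thm. 1 (p. 143)]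
[cite: MilneAV2008, I §9 Thm. 9.1 (p. 42)] -/
theorem exists_pullback_poincareQuotRigid_iso_of_level [IsReduced S] [IsLocallyNoetherian S] [IsCommMonObj D.hat.X] {g : ℕ}
    (φ : LevelStructure g n D.hat) (hn : ∀ s : S, (n : S.residueField s) ≠ 0) (hcard : Nat.card K * Nat.card K' = n ^ (2 * g))
    (hD : Nonempty ((Scheme.Modules.pullback (DualPair.unitHatSlice D)).obj D.P ≅ SheafOfModules.unit _))
    (hStab : ∀ {T : Scheme.{u}} (f : T ⟶ S) (a a' : T ⟶ D.hat.X.left) (ha : a ≫ D.hat.X.hom = f)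
      (ha' : a' ≫ D.hat.X.hom = f),
      Nonempty ((Scheme.Modules.pullback ((A.quotientBy u K hcov hG hsm hgc).baseChangeToProd D.hat f a ha)).obj
          (A.poincarePullbackBundle u K hK hcov hG hsm hgc D hfree).L ≅
        (Scheme.Modules.pullback ((A.quotientBy u K hcov hG hsm hgc).baseChangeToProd D.hat f a' ha')).obj
          (A.poincarePullbackBundle u K hK hcov hG hsm hgc D hfree).L) →
      a ≫ (D.hat.quotientMk u K' hcov').left = a' ≫ (D.hat.quotientMk u K' hcov').left)
    (hdesc : ∀ {T₁ T : Scheme.{u}} (f : T ⟶ S) (c : T₁ ⟶ T) [IsAffineHom c] [Flat c] [Surjective c]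
      (M₁ M₂ : (A.quotientBy u K hcov hG hsm hgc).RigidifiedLineBundle f),
      Nonempty ((Scheme.Modules.pullback ((A.quotientBy u K hcov hG hsm hgc).prodMap (c ≫ f) f c rfl)).obj M₁.L ≅
        (Scheme.Modules.pullback ((A.quotientBy u K hcov hG hsm hgc).prodMap (c ≫ f) f c rfl)).obj M₂.L) →
      Nonempty (M₁.L ≅ M₂.L))
    {T : Scheme.{u}} (f : T ⟶ S) (ℒ : (A.quotientBy u K hcov hG hsm hgc).RigidifiedLineBundle f) (hℒ : ℒ.FibrewisePicZero) :
    ∃ g : {g : T ⟶ (D.hat.quotientBy u K' hcov' hG' hsm' hgc').X.left //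
        g ≫ (D.hat.quotientBy u K' hcov' hG' hsm' hgc').X.hom = f},
      Nonempty ((Scheme.Modules.pullback ((A.quotientBy u K hcov hG hsm hgc).baseChangeToProd
        (D.hat.quotientBy u K' hcov' hG' hsm' hgc') f g.1 g.2)).obj
          (A.poincareQuotRigid u K hK hcov hG hsm hgc D hfree K' hcov' hG' hsm' hgc' Φ) ≅ ℒ.L) :=
  A.exists_pullback_poincareQuotRigid_iso_of_fpqcLocal u K hK hcov hG hsm hgc D hfree K' hcov' hG' hsm' hgc' hfree' Φ hStab hdesc
    (fun f' ℒ' hℒ' => A.exists_fpqcCover_pullback_poincareQuotRigid_iso_of_isLocallyNoetherian u K hK hcov hG hsm hgc D hfree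
      K' hcov' hG' hsm' hgc' hfree' Φ φ hn hcard hD hStab f' ℒ' hℒ') f ℒ hℒ

include hfree' in
/-- **THE UNIVERSAL PROPERTY OF `(Â/K′, 𝒫_B^{rig})` FROM THE LEVEL DATA — the `h4` binder of ★ `dualPairOfQuotientRigidified`
TOKEN-FOR-TOKEN, modulo exactly the stabiliser hypothesis (K) `hStab` and the fpqc-descent hypothesis (u6b) `hdesc`**; the other
inputs are the ambient `S` reduced and locally Noetherian with `n` invertible, `Â` commutative, a level-`n` structure `φ̂` on `Â`,
`#K · #K′ = n^{2g}` and the unit hypothesis `hD` ([MumfordAV1970] §15 Thm. 1: «the dual of `X/K` is `X̂/K^⊥`»; ★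
`universal_poincareQuotRigid_of_fpqcLocal` + ★ `exists_fpqcCover_pullback_poincareQuotRigid_iso_of_isLocallyNoetherian`).
[cite: MumfordAV1970, §15 Thm. 1 (p. 143)] [cite: MilneAV2008, I §8 (pp. 36–37), I §9 Thm. 9.1 (p. 42)] -/
theorem universal_poincareQuotRigid_of_level [IsReduced S] [IsLocallyNoetherian S] [IsCommMonObj D.hat.X] {g : ℕ}
    (φ : LevelStructure g n D.hat) (hn : ∀ s : S, (n : S.residueField s) ≠ 0) (hcard : Nat.card K * Nat.card K' = n ^ (2 * g))
    (hD : Nonempty ((Scheme.Modules.pullback (DualPair.unitHatSlice D)).obj D.P ≅ SheafOfModules.unit _))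
    (hStab : ∀ {T : Scheme.{u}} (f : T ⟶ S) (a a' : T ⟶ D.hat.X.left) (ha : a ≫ D.hat.X.hom = f)
      (ha' : a' ≫ D.hat.X.hom = f),
      Nonempty ((Scheme.Modules.pullback ((A.quotientBy u K hcov hG hsm hgc).baseChangeToProd D.hat f a ha)).obj
          (A.poincarePullbackBundle u K hK hcov hG hsm hgc D hfree).L ≅
        (Scheme.Modules.pullback ((A.quotientBy u K hcov hG hsm hgc).baseChangeToProd D.hat f a' ha')).obj
          (A.poincarePullbackBundle u K hK hcov hG hsm hgc D hfree).L) →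
      a ≫ (D.hat.quotientMk u K' hcov').left = a' ≫ (D.hat.quotientMk u K' hcov').left)
    (hdesc : ∀ {T₁ T : Scheme.{u}} (f : T ⟶ S) (c : T₁ ⟶ T) [IsAffineHom c] [Flat c] [Surjective c]
      (M₁ M₂ : (A.quotientBy u K hcov hG hsm hgc).RigidifiedLineBundle f),
      Nonempty ((Scheme.Modules.pullback ((A.quotientBy u K hcov hG hsm hgc).prodMap (c ≫ f) f c rfl)).obj M₁.L ≅
        (Scheme.Modules.pullback ((A.quotientBy u K hcov hG hsm hgc).prodMap (c ≫ f) f c rfl)).obj M₂.L) →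
      Nonempty (M₁.L ≅ M₂.L)) :
    ∀ {T : Scheme.{u}} (f : T ⟶ S) (ℒ : (A.quotientBy u K hcov hG hsm hgc).RigidifiedLineBundle f),
      ℒ.FibrewisePicZero →
      ∃! g : {g : T ⟶ (D.hat.quotientBy u K' hcov' hG' hsm' hgc').X.left //
          g ≫ (D.hat.quotientBy u K' hcov' hG' hsm' hgc').X.hom = f},
        Nonempty ((Scheme.Modules.pullback ((A.quotientBy u K hcov hG hsm hgc).baseChangeToProd
          (D.hat.quotientBy u K' hcov' hG' hsm' hgc') f g.1 g.2)).obj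
            (A.poincareQuotRigid u K hK hcov hG hsm hgc D hfree K' hcov' hG' hsm' hgc' Φ) ≅ ℒ.L) :=
  A.universal_poincareQuotRigid_of_fpqcLocal u K hK hcov hG hsm hgc D hfree K' hcov' hG' hsm' hgc' hfree' Φ hStab hdesc
    fun f ℒ hℒ => A.exists_fpqcCover_pullback_poincareQuotRigid_iso_of_isLocallyNoetherian u K hK hcov hG hsm hgc D hfree
      K' hcov' hG' hsm' hgc' hfree' Φ φ hn hcard hD hStab f ℒ hℒ

end AbelianSchemeOver

end Literature.AlgebraicGeometry.AbelianSchemes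

end
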